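import Summits.Ventures.YMGap.RobustBall.StringTensionOnBallW
import Summits.Ventures.YMGap.RobustBall.AreaLawRowsSU3PV2Tr
import HarnessLib

/-!
# Venture YMGap, track Y2 ROBUST-BALL — `SU(3)` STRING TENSION ON THE BALL, HYPOTHESIS-FREE to `β_W = 3/5`: the infinite-volume reading of the
# trace-norm twisted-constant (PV2Tr) area-law rows (`AreaLawRowsSU3PV2Tr`), `d = 4`, tiers 1 and 2, and the segment `0 ≤ β_W ≤ 3/5`

HONEST FRAMING.  Venture file of the cell `pub-ymgap` (QuantumFields programme), seat engine-2 (g12); 0 compute.  Strong-coupling LATTICE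
statements only; nothing about the continuum, a spectral mass gap, weak coupling, or Clay.  g11's `StringTensionOnBallSU3PV2T` verbatim on this seat's
PV2Tr rows: rb-p2's `suFundStringTension_ge_onBall` / `suFundStringTension_ge_onBallW` (every `N`; input an `AreaLawOnBall(W) N 4 β …` row BY NAME) turn
each TORUS area-law row into a statement about every INFINITE-VOLUME LIMIT STATE `μ` of every eventually-member family `𝓦` of the ball
(`perturbedLimitPoints β 𝓦`): ONE pair `(C, c)`, `c > 0`, with the `ℤ⁴` area law `HasAreaLawWith μ χ₃ C c` (`χ₃ = (1/3) Re tr`) and `c ≤ suFundStringTension 3 μ`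
WHENEVER the string tension of `μ` exists (existence NOT asserted).  Instances (class K outright):
* TIER 1 (`ClusterDomainFR (2ε) ε r`, every `r`, every `mv ≥ 1`), `(β_W; ε₀, ε₁)`: (29/50; .052, .026) ★ (3/5; .014, .007);
* TIER 2 (`ClusterDomain (log 6/5) (2ε) ε`, every `mv ≥ 1`): ★ (29/50; .012, .006);
* SEGMENT: ONE fixed ball `ClusterDomainFR (7/500) (7/1000) r` for every `0 ≤ β_W ≤ 3/5`.
WHAT MOVES: g11's hypothesis-free string tension on the ball reached `β_W = 29/50` (tier 1) / `14/25` (tier 2) / segment `≤ 1/2`; here `3/5` / `29/50` /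
segment `≤ 3/5` (on a smaller ball).  The CONDITIONAL instances (H1 ∧ H2) are untouched.
-/

noncomputable section

open MeasureTheory Filter Topology
open Literature.MathematicalPhysics.QuantumLattice
open Literature.MathematicalPhysics.QuantumFieldTheory hiding ZdEdge Site
open Literature.Barriers.QuantumFields (suFundStringTension)
open Summit.Ventures.YMGap.RobustBall

namespace Summit.Ventures.YMGap.RobustBallPV

/-! ### Tier 1 (`ClusterDomainFR (2ε) ε r`) -/

/-- **`SU(3)`, `d = 4`, `β_W = 29/50`, ball `(ε₀, ε₁) = (.052, .026)`, HYPOTHESIS-FREE: string tension on the ball** — one `c > 0` such that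
every infinite-volume limit state `μ` of every eventually-member family satisfies `HasAreaLawWith μ χ₃ C c` and, whenever its string tension exists,
`c ≤ suFundStringTension 3 μ`.  Input: `su3_pv2trRow4_29_50`. [folklore] -/
theorem su3_stringTension_onBall_pv2tr_29_50 (r : ℕ) {mv : ℕ} (hmv : 1 ≤ mv) :
    ∃ C c : ℝ, 0 < c ∧ ∀ 𝓦 : PerturbationFamily 4 3,
      (∀ᶠ L : ℕ in atTop, 𝓦 L ∈ ClusterDomainFR (2 * (13 / 500)) (13 / 500) r ∧ IsSlabLocal mv (𝓦 L)) →
        ∀ μ ∈ perturbedLimitPoints ((29 / 50 : ℝ) / 3) 𝓦,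
          HasAreaLawWith μ (fun g => normalisedCharacter 3 (fundamentalRep (Fin 3) g)) C c ∧
          ((∃ σ : ℝ, HasStringTension μ (fun g => normalisedCharacter 3 (fundamentalRep (Fin 3) g)) σ) →
            c ≤ suFundStringTension 3 μ) :=
  suFundStringTension_ge_onBall (su3_pv2trRow4_29_50 r hmv)

/-- **`SU(3)`, `d = 4`, `β_W = 3/5`, ball `(ε₀, ε₁) = (.014, .007)`, HYPOTHESIS-FREE: string tension on the ball** — one `c > 0` such that
every infinite-volume limit state `μ` of every eventually-member family satisfies `HasAreaLawWith μ χ₃ C c` and, whenever its string tension exists,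
`c ≤ suFundStringTension 3 μ`.  Input: `su3_pv2trRow4_3_5`. [folklore] -/
theorem su3_stringTension_onBall_pv2tr_3_5 (r : ℕ) {mv : ℕ} (hmv : 1 ≤ mv) :
    ∃ C c : ℝ, 0 < c ∧ ∀ 𝓦 : PerturbationFamily 4 3,
      (∀ᶠ L : ℕ in atTop, 𝓦 L ∈ ClusterDomainFR (2 * (7 / 1000)) (7 / 1000) r ∧ IsSlabLocal mv (𝓦 L)) →
        ∀ μ ∈ perturbedLimitPoints ((3 / 5 : ℝ) / 3) 𝓦,
          HasAreaLawWith μ (fun g => normalisedCharacter 3 (fundamentalRep (Fin 3) g)) C c ∧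
          ((∃ σ : ℝ, HasStringTension μ (fun g => normalisedCharacter 3 (fundamentalRep (Fin 3) g)) σ) →
            c ≤ suFundStringTension 3 μ) :=
  suFundStringTension_ge_onBall (su3_pv2trRow4_3_5 r hmv)

/-! ### Tier 2 (`ClusterDomain (log 6/5) (2ε) ε`) -/

/-- **`SU(3)`, `d = 4`, `β_W = 29/50`, TIER-2 ball `ClusterDomain (log 6/5) (.012) (.006)`, HYPOTHESIS-FREE**: the same reading, from
`su3_pv2trRowW4_29_50`. [folklore] -/
theorem su3_stringTension_onBallW_pv2tr_29_50 {mv : ℕ} (hmv : 1 ≤ mv) :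
    ∃ C c : ℝ, 0 < c ∧ ∀ 𝓦 : PerturbationFamily 4 3,
      (∀ᶠ L : ℕ in atTop, 𝓦 L ∈ ClusterDomain (Real.log (6 / 5)) (2 * (3 / 500)) (3 / 500) ∧ IsSlabLocal mv (𝓦 L)) →
        ∀ μ ∈ perturbedLimitPoints ((29 / 50 : ℝ) / 3) 𝓦,
          HasAreaLawWith μ (fun g => normalisedCharacter 3 (fundamentalRep (Fin 3) g)) C c ∧
          ((∃ σ : ℝ, HasStringTension μ (fun g => normalisedCharacter 3 (fundamentalRep (Fin 3) g)) σ) →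
            c ≤ suFundStringTension 3 μ) :=
  suFundStringTension_ge_onBallW (su3_pv2trRowW4_29_50 hmv)

/-! ### The string-tension reading of the `d = 4` segment `0 ≤ β_W ≤ 3/5` -/

/-- **`SU(3)`, `d = 4`, HYPOTHESIS-FREE: string tension on the ball for the WHOLE SEGMENT `0 ≤ β_W ≤ 3/5`** on the fixed ball
`ClusterDomainFR (7/500) (7/1000) r` — rb-p2's `suFundStringTension_ge_onBall` on `su3_pv2trRow4_upTo_3_5`. [folklore] -/
theorem su3_stringTension_onBall_pv2tr_upTo_3_5 {βW : ℝ} (h0 : 0 ≤ βW) (h : βW ≤ 3 / 5) (r : ℕ) {mv : ℕ} (hmv : 1 ≤ mv) :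
    ∃ C c : ℝ, 0 < c ∧ ∀ 𝓦 : PerturbationFamily 4 3,
      (∀ᶠ L : ℕ in atTop, 𝓦 L ∈ ClusterDomainFR (2 * (7 / 1000)) (7 / 1000) r ∧ IsSlabLocal mv (𝓦 L)) →
        ∀ μ ∈ perturbedLimitPoints (βW / 3) 𝓦,
          HasAreaLawWith μ (fun g => normalisedCharacter 3 (fundamentalRep (Fin 3) g)) C c ∧
          ((∃ σ : ℝ, HasStringTension μ (fun g => normalisedCharacter 3 (fundamentalRep (Fin 3) g)) σ) →
            c ≤ suFundStringTension 3 μ) :=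
  suFundStringTension_ge_onBall (su3_pv2trRow4_upTo_3_5 h0 h r hmv)

end Summit.Ventures.YMGap.RobustBallPV

end
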